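import Summits.ResolutionOfSingularities.ResolutionOfSingularities.Theorems.FrobeniusClosingSteerCriticalSurface
import Mathlib.RingTheory.Localization.AtPrime.Basic
import HarnessLib

/-!
# Crux `Steer` (stmt-ResolutionOfSingularities-16345), chain W4.1, p = 2 σ-residual, LOW half: the CRITICAL-SURFACE DICTIONARY
# (C7) — singular primes of the 4-fold torsor `T² = f` over the critical surface Σ₂ = V(D₁ f, D₂ f) are exactly the singular
# primes of the SURFACE double point `T² = f̄` over `R ⧸ (D₁ f, D₂ f)` (Theses-free, def-free)

OURS (campaign `res-hironaka`, rung L ★L-G4, slot W4.1; holder of record res-L0-w41-lead-1 g4 on res-L0-w41-idea-3 g2's card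
`hyperbolic-splitting-p2` v2, `L/res-L0-w41-idea-3/Sketch.lean` d722dca222cbcc1c §4, statement C7 `SingAlongCriticalSurface`; sibling
of `FrobeniusClosingSteerCriticalSurface.lean` (C1 `derivation_apply_mem_of_singular`, C2 `criticalSurface`, C3 `lowStageDichotomy`);
replaces the role of no printed item; NOT a statement of the manuscript under review [claim: Hironaka2017, status: under-review]; AI
review is weaker than expert review).

* `CriticalSurface.isUnit_det_jacobianPair` — in low shape `f − g² = l₁ l₂ + c` (`c ∈ 𝔪³`, `D₁, D₂` dual to `l₁, l₂`) the
  Jacobian matrix `((D₁ D₁ f, D₁ D₂ f), (D₂ D₁ f, D₂ D₂ f)) ≡ ((0, 1), (1, 0)) mod 𝔪` has UNIT determinant.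
* **`CriticalSurface.singAlongCriticalSurface`** (C7) — for `P₀ = (D₁ f, D₂ f)` (dim `R = 4`) and every prime `Q'` of `R ⧸ P₀`:
  `T² = f` is singular at `Q'.comap mk` IFF `T² = f̄` is singular at `Q'` (res-type-082's atPrime form on both sides). (⇒) by
  reduction along the local homomorphism `R_Q → (R ⧸ P₀)_{Q'}`; (⇐) lift and clear denominators, `U² f − γ₀² = q + A·D₁ f + B·D₂ f`
  with `q ∈ Q²`, apply `D₁, D₂` (which kill squares and map `Q²` into `Q`): `M·(A, B)ᵀ ∈ Q²`-rows with `det M` a unit, so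
  `A, B ∈ Q` and `U² f − γ₀² ∈ Q²`. Hence, with `R ⧸ Q = (R ⧸ P₀) ⧸ Q'`: curves ↔ curves, regular ↔ regular, permissible ↔
  permissible (082's `permissible_iff_of_singular` on both sides) — the σ_top run of the 4-fold torsor READ ON THE CRITICAL-SURFACE
  TOWER is the σ_top run of the surface double point (idea-3's «two dimensions down by an identity»).

Consumers: the LOW half `LowOrderTailConclTwo` of the σ-residual (skeleton r24 §σ2.15): point tails close modulo the CJS existence
fact by the local forcing argument; res-L0-w41-strat-2's B8/B9. [cite: Matsumura1987, Thm. 14.2] [folklore]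
-/

noncomputable section

-- `Summit.<S>.<S>.…` duplicates the summit name by design (single-problem summit).
set_option linter.dupNamespace false

open Polynomial IsLocalRing

namespace Summit.ResolutionOfSingularities.ResolutionOfSingularities.Theorems.SwitchingDichotomy

open Literature.AlgebraicGeometry.Resolution

namespace CriticalSurface

universe u

/-! ## (C7) Singular loci correspond along the critical surface -/

section Dictionary

variable {R : Type u} [CommRing R] [IsRegularLocalRing R] [CharP R 2]

/-- The second derivatives of a low-shape radicand: `D₁ (D₂ f) − 1`, `D₂ (D₁ f) − 1`, `D₁ (D₁ f)`, `D₂ (D₂ f)` all lie in `𝔪`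
(they are second derivatives of `c ∈ 𝔪³`), so the Jacobian matrix of the pair `(D₁ f, D₂ f)` with respect to `(D₁, D₂)` has
UNIT determinant. OURS. [folklore] -/
theorem isUnit_det_jacobianPair (f g l₁ l₂ c : R) (hf : f - g ^ 2 = l₁ * l₂ + c)
    (hc : c ∈ maximalIdeal R ^ 3) (D₁ D₂ : Derivation ℤ R R) (h11 : D₁ l₁ = 1) (h12 : D₁ l₂ = 0)
    (h21 : D₂ l₁ = 0) (h22 : D₂ l₂ = 1) :
    IsUnit (D₁ (D₁ f) * D₂ (D₂ f) - D₁ (D₂ f) * D₂ (D₁ f)) := by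
  have hfeq : f = g ^ 2 + l₁ * l₂ + c := by linear_combination hf
  have he₁ : D₁ f = l₂ + D₁ c := by
    rw [hfeq, map_add, map_add, derivation_apply_sq, D₁.leibniz, h11, h12]; simp
  have he₂ : D₂ f = l₁ + D₂ c := by
    rw [hfeq, map_add, map_add, derivation_apply_sq, D₂.leibniz, h21, h22]; simp
  have hD₁c : D₁ c ∈ maximalIdeal R ^ 2 := derivation_apply_mem_pow D₁ _ 2 hc
  have hD₂c : D₂ c ∈ maximalIdeal R ^ 2 := derivation_apply_mem_pow D₂ _ 2 hc
  have h₁₁ : D₁ (D₁ f) ∈ maximalIdeal R := by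
    rw [he₁, map_add, h12, zero_add]; exact derivation_apply_mem_of_mem_sq D₁ _ hD₁c
  have h₂₂ : D₂ (D₂ f) ∈ maximalIdeal R := by
    rw [he₂, map_add, h21, zero_add]; exact derivation_apply_mem_of_mem_sq D₂ _ hD₂c
  have h₁₂ : D₁ (D₂ f) - 1 ∈ maximalIdeal R := by
    rw [he₂, map_add, h11, add_sub_cancel_left]; exact derivation_apply_mem_of_mem_sq D₁ _ hD₂c
  have h₂₁ : D₂ (D₁ f) - 1 ∈ maximalIdeal R := by
    rw [he₁, map_add, h22, add_sub_cancel_left]; exact derivation_apply_mem_of_mem_sq D₂ _ hD₁c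
  -- `det = m − 1` with `m ∈ 𝔪`
  set m : R := D₁ (D₁ f) * D₂ (D₂ f) - (D₁ (D₂ f) - 1) * (D₂ (D₁ f) - 1) - (D₁ (D₂ f) - 1) - (D₂ (D₁ f) - 1)
    with hm_def
  have hmmem : m ∈ maximalIdeal R :=
    Ideal.sub_mem _ (Ideal.sub_mem _ (Ideal.sub_mem _ (Ideal.mul_mem_left _ _ h₂₂)
      (Ideal.mul_mem_left _ _ h₂₁)) h₁₂) h₂₁
  have hdet : D₁ (D₁ f) * D₂ (D₂ f) - D₁ (D₂ f) * D₂ (D₁ f) = m - 1 := by rw [hm_def]; ring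
  rw [hdet]
  by_contra hnu
  have hmem : m - 1 ∈ maximalIdeal R := (IsLocalRing.mem_maximalIdeal _).mpr hnu
  have h1 : (1 : R) ∈ maximalIdeal R := by
    have h := Ideal.sub_mem _ hmmem hmem
    rwa [sub_sub_cancel] at h
  exact (Ideal.ne_top_iff_one _).mp (Ideal.IsPrime.ne_top inferInstance) h1

/-- **(C7) Singular loci correspond along the critical surface** (res-L0-w41-idea-3's `SingAlongCriticalSurface`, `SingAt` UNFOLDED, with
`dim R = 4`; `P₀` is any ideal EQUAL to `(D₁ f, D₂ f)`, so that consumers instantiate with `rfl`): in low shape with dual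
derivations, for every prime `Q'` of the regular surface germ `R ⧸ P₀`, the
4-fold torsor `T² = f` is SINGULAR at `Q = Q'.comap mk` IFF the SURFACE double point `T² = f̄` over `R ⧸ P₀` is singular at `Q'`.
(⇒) reduction of `f − γ² ∈ 𝔪_Q²` along the local homomorphism `R_Q → (R ⧸ P₀)_{Q'}`. (⇐) lift and clear denominators,
`U² f − γ₀² = q + A·D₁ f + B·D₂ f` with `q ∈ Q²`; applying `D₁, D₂` (which kill squares and map `Q²` into `Q`) gives
`M·(A, B)ᵀ ∈ Q × Q` for the Jacobian matrix `M` of the pair, whose determinant is a unit (`isUnit_det_jacobianPair`), so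
`A, B ∈ Q`, `U² f − γ₀² ∈ Q²`, and `T² = f` is singular at `Q` by res-type-082's criterion. Hence curves ↔ curves, regular ↔
regular (`R ⧸ Q = (R ⧸ P₀) ⧸ Q'`), permissible ↔ permissible: the σ_top run of the 4-fold READ ON THE CRITICAL-SURFACE TOWER is the
σ_top run of the surface double point. OURS. [cite: Matsumura1987, Thm. 14.2] [folklore] -/
theorem singAlongCriticalSurface (hdim : ringKrullDim R = (4 : ℕ)) (f g l₁ l₂ l₃ l₄ c : R)
    (hf : f - g ^ 2 = l₁ * l₂ + c) (hc : c ∈ maximalIdeal R ^ 3) (hspan : Ideal.span {l₁, l₂, l₃, l₄} = maximalIdeal R)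
    (D₁ D₂ : Derivation ℤ R R) (h11 : D₁ l₁ = 1) (h12 : D₁ l₂ = 0) (h21 : D₂ l₁ = 0) (h22 : D₂ l₂ = 1)
    (P₀ : Ideal R) (hP₀ : P₀ = Ideal.span {D₁ f, D₂ f}) (Q' : Ideal (R ⧸ P₀)) [Q'.IsPrime] :
    ¬ IsRegularLocalRing (AdjoinRoot ((X : (Localization.AtPrime (Q'.comap (Ideal.Quotient.mk P₀)))[X]) ^ 2 -
      C (algebraMap R (Localization.AtPrime (Q'.comap (Ideal.Quotient.mk P₀))) f))) ↔
    ¬ IsRegularLocalRing (AdjoinRoot ((X : (Localization.AtPrime Q')[X]) ^ 2 -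
      C (algebraMap (R ⧸ P₀) (Localization.AtPrime Q') (Ideal.Quotient.mk P₀ f)))) := by
  classical
  haveI : Fact (2 : ℕ).Prime := ⟨Nat.prime_two⟩
  obtain ⟨hP0prime, -, hP0reg, -⟩ := criticalSurface hdim f g l₁ l₂ l₃ l₄ c hf hc hspan D₁ D₂ h11 h12 h21 h22
  rw [← hP₀] at hP0prime hP0reg
  have hdetu := isUnit_det_jacobianPair f g l₁ l₂ c hf hc D₁ D₂ h11 h12 h21 h22
  set π₀ : R →+* R ⧸ P₀ := Ideal.Quotient.mk P₀ with hπ₀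
  set Q : Ideal R := Q'.comap π₀ with hQ
  haveI hQprime : Q.IsPrime := Ideal.comap_isPrime π₀ Q'
  haveI : IsRegularLocalRing (R ⧸ P₀) := hP0reg
  -- characteristic 2 on the quotient and on both localisations
  haveI : Nontrivial (R ⧸ P₀) := Ideal.Quotient.nontrivial_iff.mpr (Ideal.IsPrime.ne_top hP0prime)
  haveI : CharP (R ⧸ P₀) 2 := by
    refine (CharP.charP_iff_prime_eq_zero Nat.prime_two).mpr ?_
    rw [← map_natCast π₀ 2, CharP.cast_eq_zero R 2, map_zero]
  set L := Localization.AtPrime Q with hL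
  set L' := Localization.AtPrime Q' with hL'
  haveI : IsRegularLocalRing L := isRegularLocalRing_localization_atPrime R Q
  haveI : IsRegularLocalRing L' := isRegularLocalRing_localization_atPrime (R ⧸ P₀) Q'
  haveI : CharP L 2 := AutoPermissible.charP_localization_atPrime (S := R) 2 Q
  haveI : CharP L' 2 := AutoPermissible.charP_localization_atPrime (S := R ⧸ P₀) 2 Q'
  have hP₀Q : P₀ ≤ Q := by
    intro x hx
    rw [hQ, Ideal.mem_comap, hπ₀, Ideal.Quotient.eq_zero_iff_mem.mpr hx]
    exact Q'.zero_mem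
  have he₁Q : D₁ f ∈ Q := hP₀Q (hP₀ ▸ Ideal.subset_span (by simp))
  have he₂Q : D₂ f ∈ Q := hP₀Q (hP₀ ▸ Ideal.subset_span (by simp))
  rw [RadicandSingular.not_isRegularLocalRing_adjoinRoot_atPrime_iff 2 Q f,
    RadicandSingular.not_isRegularLocalRing_adjoinRoot_atPrime_iff 2 Q' (π₀ f)]
  constructor
  · -- (⇒) reduce along the local homomorphism `R_Q → (R ⧸ P₀)_{Q'}`
    rintro ⟨γ, hγ⟩
    let φ : L →+* L' := Localization.localRingHom Q Q' π₀ rfl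
    have hmap : Ideal.map φ (maximalIdeal L) ≤ maximalIdeal L' := by
      refine Ideal.map_le_iff_le_comap.mpr fun x hx => ?_
      rw [Ideal.mem_comap]
      rw [IsLocalRing.mem_maximalIdeal, mem_nonunits_iff] at hx ⊢
      exact fun hu => hx ((isUnit_map_iff φ x).mp hu)
    refine ⟨φ γ, ?_⟩
    have h1 : φ (algebraMap R L f - γ ^ 2) = algebraMap (R ⧸ P₀) L' (π₀ f) - φ γ ^ 2 := by
      rw [map_sub, map_pow, Localization.localRingHom_to_map]
    rw [← h1]
    have h2 : φ (algebraMap R L f - γ ^ 2) ∈ Ideal.map φ (maximalIdeal L ^ 2) := Ideal.mem_map_of_mem _ hγ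
    rw [Ideal.map_pow] at h2
    exact Ideal.pow_right_mono hmap 2 h2
  · -- (⇐) lift, clear denominators, apply the derivations
    rintro ⟨γ', hγ'⟩
    obtain ⟨⟨abar, sbar⟩, rfl⟩ := IsLocalization.mk'_surjective Q'.primeCompl γ'
    obtain ⟨a, rfl⟩ := Ideal.Quotient.mk_surjective abar
    obtain ⟨s, hs⟩ := Ideal.Quotient.mk_surjective (sbar : R ⧸ P₀)
    have hsQ : s ∉ Q := by
      intro h
      have h' : Ideal.Quotient.mk P₀ s ∈ Q' := h
      rw [hs] at h'
      exact sbar.2 h'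
    -- `s̄² f̄ − ā²` maps into `𝔪_{L'}²`
    have h1 : algebraMap (R ⧸ P₀) L' (π₀ (s ^ 2 * f - a ^ 2)) ∈ maximalIdeal L' ^ 2 := by
      have hs' : algebraMap (R ⧸ P₀) L' (π₀ (s ^ 2 * f - a ^ 2)) =
          algebraMap (R ⧸ P₀) L' ((sbar : R ⧸ P₀) ^ 2) *
            (algebraMap (R ⧸ P₀) L' (π₀ f) - IsLocalization.mk' L' (π₀ a) sbar ^ 2) := by
        rw [map_sub π₀, map_mul π₀, map_pow π₀, map_pow π₀, hs, map_sub, map_mul, mul_sub, map_pow, map_pow,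
          ← mul_pow, IsLocalization.mk'_spec' L' (π₀ a) sbar]
      rw [hs']
      exact Ideal.mul_mem_left _ _ hγ'
    rw [← Localization.AtPrime.map_eq_maximalIdeal, ← Ideal.map_pow,
      IsLocalization.algebraMap_mem_map_algebraMap_iff Q'.primeCompl] at h1
    obtain ⟨ubar, hubar, h2⟩ := h1
    obtain ⟨u, rfl⟩ := Ideal.Quotient.mk_surjective ubar
    have huQ : u ∉ Q := fun h => hubar (by rw [hQ, Ideal.mem_comap] at h; exact h)
    -- pull back to `R`: `u (s² f − a²) ∈ Q² + P₀`
    have hQ'map : Q' = Ideal.map π₀ Q := by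
      rw [hQ, Ideal.map_comap_of_surjective _ Ideal.Quotient.mk_surjective]
    have h3 : π₀ (u * (s ^ 2 * f - a ^ 2)) ∈ Ideal.map π₀ (Q ^ 2) := by
      rw [Ideal.map_pow, ← hQ'map, map_mul]
      exact h2
    obtain ⟨q, hq, hq'⟩ := (Ideal.mem_map_iff_of_surjective π₀ Ideal.Quotient.mk_surjective).mp h3
    have h4 : u * (s ^ 2 * f - a ^ 2) - q ∈ P₀ := by
      rw [← Ideal.Quotient.eq, hq']
    rw [hP₀] at h4
    obtain ⟨a₀, b₀, hab⟩ := Ideal.mem_span_pair.mp h4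
    -- multiply by `u`: `U² f − γ₀² = q₁ + A e₁ + B e₂`
    have hUQ : u * s ∉ Q := fun h => (Ideal.IsPrime.mem_or_mem inferInstance h).elim huQ hsQ
    have hq₁Q : u * q ∈ Q ^ 2 := Ideal.mul_mem_left _ _ hq
    have key : (u * s) ^ 2 * f - (u * a) ^ 2 = u * q + (u * a₀) * D₁ f + (u * b₀) * D₂ f := by
      have h : u * (u * (s ^ 2 * f - a ^ 2) - q) = u * (a₀ * D₁ f + b₀ * D₂ f) := by rw [hab]
      linear_combination h
    -- apply `D₁`, `D₂`: the rows `A·D(D₁ f) + B·D(D₂ f) ∈ Q`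
    have hrow : ∀ D : Derivation ℤ R R, D f ∈ Q →
        (u * a₀) * D (D₁ f) + (u * b₀) * D (D₂ f) ∈ Q := by
      intro D hDf
      have hl : D ((u * s) ^ 2 * f - (u * a) ^ 2) = (u * s) ^ 2 * D f := by
        rw [map_sub, D.leibniz, derivation_apply_sq, derivation_apply_sq]; simp [smul_eq_mul]
      have hr : D (u * q + (u * a₀) * D₁ f + (u * b₀) * D₂ f) =
          D (u * q) + D₁ f * D (u * a₀) + D₂ f * D (u * b₀) +
            ((u * a₀) * D (D₁ f) + (u * b₀) * D (D₂ f)) := by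
        rw [map_add, map_add, D.leibniz (u * a₀), D.leibniz (u * b₀)]
        simp only [smul_eq_mul]
        ring
      have h5 : (u * a₀) * D (D₁ f) + (u * b₀) * D (D₂ f) =
          (u * s) ^ 2 * D f - D (u * q) - D₁ f * D (u * a₀) - D₂ f * D (u * b₀) := by
        have h := congrArg D key
        rw [hl, hr] at h
        linear_combination -h
      rw [h5]
      refine Ideal.sub_mem _ (Ideal.sub_mem _ (Ideal.sub_mem _ (Ideal.mul_mem_left _ _ hDf)
        (derivation_apply_mem_of_mem_sq D Q hq₁Q)) (Ideal.mul_mem_right _ _ he₁Q)) (Ideal.mul_mem_right _ _ he₂Q)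
    have r1 := hrow D₁ he₁Q
    have r2 := hrow D₂ he₂Q
    -- Cramer with the unit determinant
    set d : R := D₁ (D₁ f) * D₂ (D₂ f) - D₁ (D₂ f) * D₂ (D₁ f) with hd
    have hdQ : d ∉ Q := fun h => (Ideal.IsPrime.ne_top inferInstance)
      (Ideal.eq_top_of_isUnit_mem _ h hdetu)
    have hA : u * a₀ ∈ Q := by
      have h : d * (u * a₀) = D₂ (D₂ f) * ((u * a₀) * D₁ (D₁ f) + (u * b₀) * D₁ (D₂ f)) -
          D₁ (D₂ f) * ((u * a₀) * D₂ (D₁ f) + (u * b₀) * D₂ (D₂ f)) := by rw [hd]; ring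
      have hmem : d * (u * a₀) ∈ Q := by
        rw [h]; exact Ideal.sub_mem _ (Ideal.mul_mem_left _ _ r1) (Ideal.mul_mem_left _ _ r2)
      exact (Ideal.IsPrime.mem_or_mem inferInstance hmem).resolve_left hdQ
    have hB : u * b₀ ∈ Q := by
      have h : d * (u * b₀) = D₁ (D₁ f) * ((u * a₀) * D₂ (D₁ f) + (u * b₀) * D₂ (D₂ f)) -
          D₂ (D₁ f) * ((u * a₀) * D₁ (D₁ f) + (u * b₀) * D₁ (D₂ f)) := by rw [hd]; ring
      have hmem : d * (u * b₀) ∈ Q := by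
        rw [h]; exact Ideal.sub_mem _ (Ideal.mul_mem_left _ _ r2) (Ideal.mul_mem_left _ _ r1)
      exact (Ideal.IsPrime.mem_or_mem inferInstance hmem).resolve_left hdQ
    -- hence `U² f − γ₀² ∈ Q²`
    have hsq : (u * s) ^ 2 * f - (u * a) ^ 2 ∈ Q ^ 2 := by
      rw [key, pow_two]
      refine Ideal.add_mem _ (Ideal.add_mem _ (by rw [← pow_two]; exact hq₁Q) (Ideal.mul_mem_mul hA he₁Q))
        (Ideal.mul_mem_mul hB he₂Q)
    -- and `f − (γ₀/U)² ∈ 𝔪_L²`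
    have hUs : u * s ∈ Q.primeCompl := hUQ
    refine ⟨IsLocalization.mk' L (u * a) ⟨u * s, hUs⟩, ?_⟩
    have hunit : IsUnit (algebraMap R L ((u * s) ^ 2)) := by
      rw [map_pow]; exact (IsLocalization.map_units L ⟨u * s, hUs⟩).pow 2
    rw [← Ideal.unit_mul_mem_iff_mem _ hunit]
    have heq : algebraMap R L ((u * s) ^ 2) * (algebraMap R L f - IsLocalization.mk' L (u * a) ⟨u * s, hUs⟩ ^ 2) =
        algebraMap R L ((u * s) ^ 2 * f - (u * a) ^ 2) := by
      rw [map_sub, map_mul, mul_sub, map_pow, map_pow (algebraMap R L) (u * a), ← mul_pow]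
      congr 2
      exact IsLocalization.mk'_spec' L (u * a) ⟨u * s, hUs⟩
    rw [heq, ← Localization.AtPrime.map_eq_maximalIdeal, ← Ideal.map_pow]
    exact Ideal.mem_map_of_mem _ hsq

end Dictionary

end CriticalSurface

end Summit.ResolutionOfSingularities.ResolutionOfSingularities.Theorems.SwitchingDichotomy

end
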